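import Mathlib
import HarnessLib.Audit
import Summits.PneNP.PneNP.Theorems.PstarNorUnitEQ1Three

/-!
# Case A, the all-(EQ) corner of a union-terminal core is a triangle (ROUND-24, memo §14.16–§14.20; union port of `PstarNorUnitEQ1Three.eq1_three`)

FRONTIER range-avoidance ladder, rung F-N3, ROUND 24 (cell `pnp-ideate`, planner memo `r24/CORE-BOUND-NOTES.md` §14.16–§14.20, CASE A MASTER PLAN of planner p3 g22;
restricted-model proof complexity — nothing here bears on `P` versus `NP`).

`PstarNorUnitEQ1Three.eq1_three` closes the single-(EQ)-chord corner of a TERMINAL core: `N = {e₀}`, `Q_{D e₀} = q + κ` ⟹ `#J₀ = 3`.  Its proof uses minimality (M0)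
twice: at the chord `e₀` (for the (★★) containment `Z(q) ⊆ {u_{e₀} = 1}`) and at ONE forest output `j ∈ D e₀` (the forest point).  In Case A of the union lemma
(`PstarUnionRankSixBridge`: reader `A = (C₁, G₁, b₁)`, shared constraint `w₂ = (C₂, G₂, b₂)` blind on the privates, hun) the containment is supplied by hardness
(`PstarUnionRankSixBridge.forced_of_cover`), and the union cover releases SOME reader at `j`; so the same argument runs for the bridge data of THAT reader:

* `qDir_one_zero`, `qDir_zero_one`, `polarDir_one_zero`, `polarDir_zero_one` — the Case-A directions: reads along `m = (1,0)`, `q_m = free₂ + b₂`, partner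
  `q_{(0,1)} = free₁ + b₁`;
* `eq1_caseA` — **the all-(EQ) corner**: well-formed liftable bridge data (reader, `w₂`) with hun, `w₂` blind, (T3), every chord forced on `Z(q) ≠ ∅`, `N = {e₀}`,
  `Q_{D e₀} = q + κ`, and a solution of `(J₀ − j) ∧ A ∧ w₂` for ONE `j ∈ D e₀` ⟹ `#J₀ = 3`.  Proof verbatim `eq1_three` in the un-mapped single-read system:
  infeasibility at the all-ON state gives `{q̃ = 0} ⊆ {Q = κ + 1}` for `q̃ := q_{(0,1)} + c`; at the forest point `q = 1`, `Q = κ + 1`, privates ON, `q̃ = [j ∈ T₁]`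
  `= polarDir_{(0,1)}(p_j, q_j)`; `PstarForcing.forcing_cases (Q, q̃)`: constant and (EQ′) die on that value, (EXC′) (`PstarNorUnitExcCore.exc_unit_core`) and (NOR′)
  (`PstarNorUnitEQ1Tools.nor_unit_of_dir_const`) make `D e₀` a CONS-T pair, so `J₀ = D e₀ + e₀` (`PstarNorUnitRegime.J₀_eq_of_single`) is a triangle.
-/

set_option linter.dupNamespace false -- `Summit.PneNP.PneNP.…`: summit = sub-problem name (D-0017 single-conjunct layout)

open Finset Module Literature.Computability.Complexity
open Summit.PneNP.PneNP.Theorems.PstarFibrePolys (bit)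
open Summit.PneNP.PneNP.Theorems.PstarTyped (Typed)
open Summit.PneNP.PneNP.Theorems.PstarSALevel (varSet bdry BoundaryExpanding SimpleOverlap)
open Summit.PneNP.PneNP.Theorems.PstarCoreBound (XorClosed)
open Summit.PneNP.PneNP.Theorems.PstarGapLinearised (andPair)
open Summit.PneNP.PneNP.Theorems.PstarCubeIdeals (IsAffineFn)
open Summit.PneNP.PneNP.Theorems.PstarQuadRank (rad)
open Summit.PneNP.PneNP.Theorems.PstarForcing (polar_unique forcing_cases)
open Summit.PneNP.PneNP.Theorems.PstarProductRank (qform polar)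
open Summit.PneNP.PneNP.Theorems.PstarPathRank (AndAdj polar_basis)
open Summit.PneNP.PneNP.Theorems.PstarChordSystem (ChordSystem)
open Summit.PneNP.PneNP.Theorems.PstarChordBridgeTools (xpdeg privs vars_mem_privs uval free)
open Summit.PneNP.PneNP.Theorems.PstarChordBridge (BridgeData sys Solution Lift sys_u sys_F sys_t infeasible_of_not_solution)
open Summit.PneNP.PneNP.Theorems.PstarReadSumset (V2)
open Summit.PneNP.PneNP.Theorems.PstarChordBridgeFundamental (two_le_card_of_even)
open Summit.PneNP.PneNP.Theorems.PstarChordBridgeForcing (freeMon freePolar gam sys_u_eq qform_add' rank_four_of_wf const_of_unread singleRead_of_untouched)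
open Summit.PneNP.PneNP.Theorems.PstarChordBridgeCotree (Peelable)
open Summit.PneNP.PneNP.Theorems.PstarChordBridgeBasis (qDir polarDir)
open Summit.PneNP.PneNP.Theorems.PstarChordBridgeForest (forest_minimality defect_eq_one)
open Summit.PneNP.PneNP.Theorems.PstarNorUnitEQ1Tools (polarDir_single_pair nor_unit_of_dir_const)
open Summit.PneNP.PneNP.Theorems.PstarChordBridgeCorner (andAdj_iff_mem qDir_add)
open Summit.PneNP.PneNP.Theorems.PstarNorUnitRegime (J₀_eq_of_single)
open Summit.PneNP.PneNP.Theorems.PstarNorUnitExcCore (exc_unit_core)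

namespace Summit.PneNP.PneNP.Theorems.PstarUnionCaseAEQ1

variable {n m : ℕ}

/-! ## The Case-A directions -/

/-- `q_{(1,0)} = free₂ + b₂` — the second constraint itself. -/
theorem qDir_one_zero (I : LocalMap 4 n m) (B : BridgeData n m) (x : Fin n → ZMod 2) :
    qDir I B ((1 : ZMod 2), (0 : ZMod 2)) x = free I B.y (B.J₀ \ B.N) B.N B.T₂ B.C₂ B.G₂ x + bit B.b₂ := by
  unfold qDir
  rw [zero_mul, one_mul, zero_add]

/-- `q_{(0,1)} = free₁ + b₁` — the reader itself. -/
theorem qDir_zero_one (I : LocalMap 4 n m) (B : BridgeData n m) (x : Fin n → ZMod 2) :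
    qDir I B ((0 : ZMod 2), (1 : ZMod 2)) x = free I B.y (B.J₀ \ B.N) B.N B.T₁ B.C₁ B.G₁ x + bit B.b₁ := by
  unfold qDir
  rw [zero_mul, one_mul, add_zero]

/-- The polar form of `q_{(1,0)}`. -/
theorem polarDir_one_zero (I : LocalMap 4 n m) (B : BridgeData n m) :
    polarDir I B ((1 : ZMod 2), (0 : ZMod 2)) = freePolar I B.N B.T₂ B.G₂ := by
  unfold polarDir
  rw [zero_smul, one_smul, zero_add]

/-- The polar form of `q_{(0,1)}`. -/
theorem polarDir_zero_one (I : LocalMap 4 n m) (B : BridgeData n m) :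
    polarDir I B ((0 : ZMod 2), (1 : ZMod 2)) = freePolar I B.N B.T₁ B.G₁ := by
  unfold polarDir
  rw [zero_smul, one_smul, add_zero]

/-! ## The all-(EQ) corner -/

/-- **The all-(EQ) corner of Case A is a triangle.**  See the module docstring. -/
theorem eq1_caseA (I : LocalMap 4 n m) (hI : I.IsPure xorAndPred) (hT : Typed I) (hS : SimpleOverlap I) {r : ℕ}
    (hB : BoundaryExpanding r I) {B : BridgeData n m} (hW : B.WF I) (hr : (B.J₀ ∪ B.G₁ ∪ B.G₂).card ≤ r)
    (hX : XorClosed I B.J₀) (hP : Peelable I (B.J₀ \ B.N)) (hG₁ : Disjoint B.G₁ B.J₀) (hG₂ : Disjoint B.G₂ B.J₀) (hL : Lift I B)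
    (hun : ∀ v ∈ privs I B.N, (∀ g ∈ B.G₁, I.vars g 2 ≠ v ∧ I.vars g 3 ≠ v) ∧ ∀ g ∈ B.G₂, I.vars g 2 ≠ v ∧ I.vars g 3 ≠ v)
    (hblind : ∀ v ∈ privs I B.N, v ∉ B.C₂) (hT3 : ¬ ∃ z, Solution I B B.J₀ z)
    (hforced : ∀ e ∈ B.N, ∀ a, free I B.y (B.J₀ \ B.N) B.N B.T₂ B.C₂ B.G₂ a = bit B.b₂ → uval I B.y (B.D e) e a = 1)
    (hZne : ∃ a, free I B.y (B.J₀ \ B.N) B.N B.T₂ B.C₂ B.G₂ a = bit B.b₂)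
    {e₀ : Fin m} (hN : B.N = {e₀}) {κ : ZMod 2}
    (hEQ : ∀ x, qform (B.D e₀) (fun j => I.vars j 2) (fun j => I.vars j 3) x = qDir I B ((1 : ZMod 2), (0 : ZMod 2)) x + κ)
    {j : Fin m} (hj : j ∈ B.D e₀) {z : Fin n → Bool} (hz : Solution I B (B.J₀.erase j) z) :
    B.J₀.card = 3 := by
  classical
  -- `𝔽₂` bookkeeping
  have z01 : ∀ a : ZMod 2, a = 0 ∨ a = 1 := by decide
  have zaa : ∀ a : ZMod 2, a + a = 0 := by decide
  have e2 : ∀ a b : ZMod 2, a + b = 0 → a = b := by decide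
  set mv : V2 := ((1 : ZMod 2), (0 : ZMod 2)) with hmv
  set pm : V2 := ((0 : ZMod 2), (1 : ZMod 2)) with hpm
  have he₀ : e₀ ∈ B.N := by rw [hN]; exact mem_singleton_self _
  have heD : e₀ ∉ B.D e₀ := fun h => (mem_sdiff.1 (hW.hD e₀ he₀ h)).2 he₀
  have hJr : B.J₀.card ≤ r := (card_le_card (subset_union_left.trans subset_union_left)).trans hr
  have heG : e₀ ∉ B.G₁ ∪ B.G₂ := fun h => by
    rcases mem_union.1 h with h | h
    · exact Finset.disjoint_left.1 hG₁ h (hW.hN he₀)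
    · exact Finset.disjoint_left.1 hG₂ h (hW.hN he₀)
  -- the (un-mapped, already single-read) model
  set S := sys I B with hS'
  have hSR : S.SingleRead := singleRead_of_untouched I B fun v hv => ⟨hblind v hv, (hun v hv).2⟩
  have hconst : ∀ e a a', S.ρ e a = S.ρ e a' ∧ S.ρ' e a = S.ρ' e a' := const_of_unread I B hun
  have hinf : S.Infeasible B.N := infeasible_of_not_solution I hI hT hW hL hT3
  have hq2 : ∀ x, (S.F x).2 + S.t.2 = qDir I B mv x := fun x => by rw [hS', sys_F, sys_t, hmv, qDir_one_zero]
  have hq1 : ∀ x, (S.F x).1 + S.t.1 = qDir I B pm x := fun x => by rw [hS', sys_F, sys_t, hpm, qDir_zero_one]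
  have hu : ∀ x, S.u e₀ x = gam B e₀ + qform (B.D e₀) (fun j => I.vars j 2) (fun j => I.vars j 3) x := fun x => sys_u_eq I B e₀ x
  have hZ_iff : ∀ x, (S.F x).2 = S.t.2 ↔ qDir I B mv x = 0 := by
    intro x
    rw [← hq2 x]
    constructor
    · intro h; rw [h]; exact zaa _
    · intro h; exact e2 _ _ h
  have hstar : ∀ x, (S.F x).2 = S.t.2 → S.u e₀ x = 1 := by
    intro x hx
    rw [hS', sys_u]
    refine hforced e₀ he₀ x ?_
    have h := (hZ_iff x).1 hx
    rw [hmv, qDir_one_zero] at h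
    exact e2 _ _ h
  -- `γ + κ = 1`
  have hγκ : gam B e₀ + κ = 1 := by
    obtain ⟨a, ha⟩ := hZne
    have hqa : qDir I B mv a = 0 := by rw [hmv, qDir_one_zero, ha]; exact zaa _
    have h1 := hstar a ((hZ_iff a).2 hqa)
    rw [hu, hEQ a, hqa, zero_add] at h1
    exact h1
  -- the read constant of the first coordinate and the key containment
  set cpar : ZMod 2 := (S.ρ e₀ 0).1 + (S.ρ' e₀ 0).1 with hcpar
  have hvalON : ∀ x (s : Fin m → ZMod 2 × ZMod 2), s e₀ = (1, 1) → S.val B.N x s = S.F x + (S.ρ e₀ 0 + S.ρ' e₀ 0) := by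
    intro x s hs
    unfold ChordSystem.val ChordSystem.contrib
    rw [hN, sum_singleton, hs, (hconst e₀ x 0).1, (hconst e₀ x 0).2]
    simp only [one_smul]
  have hkey : ∀ x, qDir I B mv x = 0 → qDir I B pm x = cpar + 1 := by
    intro x hx
    have hZx : (S.F x).2 = S.t.2 := (hZ_iff x).2 hx
    have hu1 : S.u e₀ x = 1 := hstar x hZx
    have hadm : S.Adm B.N x (fun _ => ((1 : ZMod 2), (1 : ZMod 2))) := by
      intro e he
      rw [hN, mem_singleton] at he
      subst he
      show (1 : ZMod 2) * 1 = S.u e x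
      rw [one_mul, hu1]
    have hne := hinf x _ hadm
    rw [hvalON x _ rfl] at hne
    rcases z01 (qDir I B pm x + cpar) with h0 | h1
    · exfalso
      apply hne
      refine Prod.ext ?_ ?_
      · have h := hq1 x
        simp only [Prod.fst_add]
        have e3 : ∀ f t ρ : ZMod 2, f + t = ρ → f + ρ = t := by decide
        refine e3 _ _ _ (h.trans ?_)
        have e4 : ∀ q c : ZMod 2, q + c = 0 → q = c := by decide
        exact e4 _ _ h0
      · simp only [Prod.snd_add]
        rw [(hSR e₀ 0).1, (hSR e₀ 0).2, add_zero, add_zero]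
        exact hZx
    · have e5 : ∀ q c : ZMod 2, q + c = 1 → q = c + 1 := by decide
      exact e5 _ _ h1
  -- the shifted first coordinate `q̃ = q_{(0,1)} + c` and the containment `{q̃ = 0} ⊆ {Q = κ + 1}`
  set qt : (Fin n → ZMod 2) → ZMod 2 := fun x => qDir I B pm x + cpar with hqt
  have hZt : ∀ x, qt x = 0 → qform (B.D e₀) (fun j => I.vars j 2) (fun j => I.vars j 3) x = κ + 1 := by
    intro x hx
    have hx' : qDir I B pm x = cpar := by
      have e4 : ∀ q c : ZMod 2, q + c = 0 → q = c := by decide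
      exact e4 _ _ hx
    rcases z01 (qDir I B mv x) with h0 | h1
    · have := hkey x h0
      rw [hx'] at this
      exact absurd this (by generalize cpar = c; revert c; decide)
    · rw [hEQ x, h1, add_comm]
  have hBt : ∀ x w, qt (x + w) = qt x + qt w + qt 0 + polarDir I B pm x w := by
    intro x w
    show qDir I B pm (x + w) + cpar = qDir I B pm x + cpar + (qDir I B pm w + cpar) + (qDir I B pm 0 + cpar) + polarDir I B pm x w
    rw [qDir_add]
    generalize qDir I B pm x = s; generalize qDir I B pm w = s'; generalize qDir I B pm 0 = s₀
    generalize polarDir I B pm x w = t; generalize cpar = c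
    revert s s' s₀ t c; decide
  have hrank := rank_four_of_wf I hI hS hB hW hJr he₀
  -- (★): `(EQ)` pins the polar form of `q_m` to that of `Q`
  have hpolQ : polar (B.D e₀) (fun j => I.vars j 2) (fun j => I.vars j 3) = polarDir I B mv := by
    refine polar_unique (qform_add' I (B.D e₀)) fun x w => ?_
    rw [hEQ (x + w), hEQ x, hEQ w, hEQ 0, qDir_add]
    generalize qDir I B mv x = s; generalize qDir I B mv w = s'; generalize qDir I B mv 0 = s₀
    generalize polarDir I B mv x w = t; generalize κ = c
    revert s s' s₀ t c; decide
  have hstarj : ∀ j ∈ B.D e₀, mv.2 * (if j ∈ B.T₁ then 1 else 0) + mv.1 * (if j ∈ B.T₂ then 1 else 0) = (1 : ZMod 2) := by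
    intro j hj
    have hjJ : j ∈ B.J₀ := (mem_sdiff.1 (hW.hD e₀ he₀ hj)).1
    have h := LinearMap.congr_fun (LinearMap.congr_fun hpolQ (Pi.single (I.vars j 2) 1)) (Pi.single (I.vars j 3) 1)
    rw [polar_basis I hI hS, if_pos ((andAdj_iff_mem I hI hS _ j).2 hj), polarDir_single_pair I hI hS hG₁ hG₂ mv hjJ] at h
    exact h.symm
  -- the forest point: the given path edge `j ∈ D e₀` and the given solution of `J₀ − j`
  have hjJ : j ∈ B.J₀ := (mem_sdiff.1 (hW.hD e₀ he₀ hj)).1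
  have hpriv : ∀ G : Finset (Fin m), (∀ v ∈ privs I B.N, ∀ g ∈ G, I.vars g 2 ≠ v ∧ I.vars g 3 ≠ v) →
      ∀ g ∈ G, I.vars g 2 ≠ I.vars e₀ 2 ∧ I.vars g 2 ≠ I.vars e₀ 3 ∧ I.vars g 3 ≠ I.vars e₀ 2 ∧ I.vars g 3 ≠ I.vars e₀ 3 := by
    intro G hG g hg
    have h2 := hG _ (vars_mem_privs I he₀ (s := 2) (by decide)) g hg
    have h3 := hG _ (vars_mem_privs I he₀ (s := 3) (by decide)) g hg
    exact ⟨h2.1, h3.1, h2.2, h3.2⟩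
  have hGp₁ := hpriv B.G₁ fun v hv => (hun v hv).1
  have hGp₂ := hpriv B.G₂ fun v hv => (hun v hv).2
  obtain ⟨-, hval⟩ := forest_minimality I hI hT hW he₀ hj hGp₁ hGp₂ hz
  have hδ := defect_eq_one I hI hW he₀ hj hT3 hz
  set xz : Fin n → ZMod 2 := fun v => bit (z v) with hxz
  set sz : Fin m → ZMod 2 × ZMod 2 := fun e => (bit (z (I.vars e 2)), bit (z (I.vars e 3))) with hsz
  rw [hδ] at hval
  have hval' : S.val B.N xz sz = S.t + ((if j ∈ B.T₁ then (1 : ZMod 2) else 0), (if j ∈ B.T₂ then (1 : ZMod 2) else 0)) := hval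
  have hsj := hstarj j hj
  -- second coordinate at the forest point: `q_m = 1`, so `Q = κ + 1`, `u = 0`, `p = p' = 1`
  have h2c : qDir I B mv xz = 1 := by
    have h := congrArg Prod.snd hval'
    rw [S.val_snd_of_singleRead hSR, Prod.snd_add] at h
    rw [← hq2 xz, h]
    dsimp only
    revert hsj
    rw [hmv]
    generalize S.t.2 = t
    generalize (if j ∈ B.T₁ then (1 : ZMod 2) else 0) = i1; generalize (if j ∈ B.T₂ then (1 : ZMod 2) else 0) = i2
    revert t i1 i2; decide
  have hQx : qform (B.D e₀) (fun j => I.vars j 2) (fun j => I.vars j 3) xz = κ + 1 := by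
    rw [hEQ xz, h2c, add_comm]
  have hpp : bit (z (I.vars e₀ 2)) = 1 ∧ bit (z (I.vars e₀ 3)) = 1 := by
    have hu0 : (sys I B).u e₀ xz = 0 := by
      rw [sys_u_eq I B e₀ xz, hQx, ← add_assoc, hγκ]
      decide
    rw [hu0, zero_add] at hδ
    have e6 : ∀ a b : ZMod 2, a * b = 1 → a = 1 ∧ b = 1 := by decide
    exact e6 _ _ hδ
  have hsz₀ : sz e₀ = (1, 1) := by
    show (bit (z (I.vars e₀ 2)), bit (z (I.vars e₀ 3))) = (1, 1)
    rw [hpp.1, hpp.2]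
  -- first coordinate at the forest point: `q̃(xz) = [j ∈ T₁]`
  have h1c : qt xz = pm.2 * (if j ∈ B.T₁ then 1 else 0) + pm.1 * (if j ∈ B.T₂ then 1 else 0) := by
    have h := congrArg Prod.fst hval'
    rw [hvalON xz sz hsz₀, Prod.fst_add, Prod.fst_add, Prod.fst_add] at h
    show qDir I B pm xz + cpar = _
    rw [← hq1 xz, hcpar, hpm]
    dsimp only at h
    revert h
    generalize (S.F xz).1 = f; generalize S.t.1 = t; generalize (S.ρ e₀ 0).1 = ρ₁; generalize (S.ρ' e₀ 0).1 = ρ₂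
    generalize (if j ∈ B.T₁ then (1 : ZMod 2) else 0) = i1; generalize (if j ∈ B.T₂ then (1 : ZMod 2) else 0) = i2
    revert f t ρ₁ ρ₂ i1 i2; decide
  have hπ : polarDir I B pm (Pi.single (I.vars j 2) 1) (Pi.single (I.vars j 3) 1) = qt xz := by
    rw [h1c, polarDir_single_pair I hI hS hG₁ hG₂ pm hjJ]
  -- a constant `q̃` is impossible
  have not_const : ¬ ∀ x, qt x = 1 := by
    intro h1
    have hzero : polarDir I B pm (Pi.single (I.vars j 2) 1) (Pi.single (I.vars j 3) 1) = 0 := by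
      have := hBt (Pi.single (I.vars j 2) 1) (Pi.single (I.vars j 3) 1)
      rw [h1, h1, h1, h1] at this
      have e8 : ∀ t : ZMod 2, (1 : ZMod 2) = 1 + 1 + 1 + t → t = 0 := by decide
      exact e8 _ this
    rw [hπ, h1 xz] at hzero
    exact one_ne_zero hzero
  -- (EQ″) against `q̃` is impossible
  have no_EQ' : ∀ κ' : ZMod 2, (∀ x, qform (B.D e₀) (fun j => I.vars j 2) (fun j => I.vars j 3) x = qt x + κ') → False := by
    intro κ' hκ'
    have hpol2 : polar (B.D e₀) (fun j => I.vars j 2) (fun j => I.vars j 3) = polarDir I B pm := by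
      refine polar_unique (qform_add' I (B.D e₀)) fun x w => ?_
      rw [hκ' (x + w), hκ' x, hκ' w, hκ' 0, hBt]
      generalize qt x = s; generalize qt w = s'; generalize qt 0 = s₀
      generalize polarDir I B pm x w = t; generalize κ' = c
      revert s s' s₀ t c; decide
    have hone : qt xz = 1 := by
      have h := LinearMap.congr_fun (LinearMap.congr_fun hpol2 (Pi.single (I.vars j 2) 1)) (Pi.single (I.vars j 3) 1)
      rw [polar_basis I hI hS, if_pos ((andAdj_iff_mem I hI hS _ j).2 hj), hπ] at h
      exact h.symm
    have hκ₁ : κ' = κ := by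
      have h := hκ' xz
      rw [hQx, hone] at h
      have e9 : ∀ a b : ZMod 2, a + 1 = 1 + b → b = a := by decide
      exact e9 _ _ h
    obtain ⟨x₀, hx₀⟩ : ∃ x₀, qt x₀ = 0 := by
      by_contra hno
      push Not at hno
      exact not_const fun x => (z01 (qt x)).resolve_left (hno x)
    have h := hκ' x₀
    rw [hZt x₀ hx₀, hx₀, zero_add, hκ₁] at h
    exact absurd h (by generalize κ = c; revert c; decide)
  -- run the forcing table on `(Q, q̃)`
  rcases forcing_cases hBt (qform_add' I (B.D e₀)) hrank hZt with h1 | ⟨κ', hκ'⟩ | ⟨ν₁, ν₂, hν₁, hν₂, κ', h⟩ |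
      ⟨a, b, -, hqf, m₁, m₂, hm₁, hm₂, hQf⟩
  · exact absurd h1 not_const
  · exact (no_EQ' κ' hκ').elim
  · rcases exc_unit_core I hI hS hB hW hr he₀ heG pm hBt hZt hν₁ hν₂ h with ⟨κ'', hκ''⟩ | ⟨j₁, j₂, σ, τ', hne, hDe, -⟩
    · exact (no_EQ' κ'' hκ'').elim
    · rw [J₀_eq_of_single I hI hT hW hX hP hN, card_insert_of_notMem heD, hDe, card_pair hne]
  · have hq'' : ∀ x, qDir I B pm x = (polarDir I B pm x b + (qt b + qt 0)) * (polarDir I B pm x a + (qt a + qt 0)) + (1 + cpar) := by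
      intro x
      have hx := hqf x
      have e10 : ∀ q c P : ZMod 2, q + c = P + 1 → q = P + (1 + c) := by decide
      exact e10 _ _ _ hx
    obtain ⟨j₁, j₂, σ, τ', hne, hDe, -⟩ :=
      nor_unit_of_dir_const I hI hS hB hW hr he₀ heG pm hq'' hm₁ hm₂ (c := κ + 1) hQf
    rw [J₀_eq_of_single I hI hT hW hX hP hN, card_insert_of_notMem heD, hDe, card_pair hne]

end Summit.PneNP.PneNP.Theorems.PstarUnionCaseAEQ1
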